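import Literature.AlgebraicGeometry.Hironaka2017.Datum
import HarnessLib

/-!
# REVIEW-RUNBOOK sanity lemma — the termination schema `Datum.terminates_of_eventual_drop` has a model
# (client `pub-hironaka` of the ops review-runbook generator, card S `Datum.terminates_of_eventual_drop`)

Card (2)(b) («non-vacuity») of `run/shared/lean/pub/pub-hironaka/REVIEW-RUNBOOK.md` (archived cell
hironaka-charp, NEGATIVE verdict).  `terminates_of_eventual_drop` is the ABSTRACT form of §16.3 of the
manuscript: states `σ`, one permissible step, a datum in a type with a well-founded «smaller» relation,
a predicate «resolved», and the hypothesis `drop` — every unresolved state reaches, after finitely many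
steps, a state with strictly smaller datum (the content the manuscript does NOT establish) — give
termination.  Its two hypotheses (`wf`, `drop`) are library-phrased; this file records ONE closed theorem
`∃ rel datum resolved step, wf ∧ drop` (the shape the generator's probe matches) exhibiting a model of the
schema — the COUNTDOWN system on `ℕ` (`σ = D = ℕ`, datum `= id`, «smaller» `= (<)`, resolved `= (· = 0)`,
one step `s ↦ s − 1`): the telescope is consistent and the certified implication not vacuous.  A TOY
model by design: it says nothing about Hironaka's ideal exponents, whose `drop` is the open point.

Placed under the char-`p` resolution topic `KangarooAtlas` (whose edge-datum modules import
`Literature.AlgebraicGeometry.Hironaka2017.*`); review evidence only (topic module, closes no item);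
no definitions, no `sorry`, standard axioms.
-/

namespace Summit.ResolutionOfSingularities.KangarooAtlas.Runbook

/-- (b) **The two hypotheses of `Hironaka2017.Datum.terminates_of_eventual_drop` hold together** in the
countdown model on `ℕ`: states and data `ℕ`, datum `id`, «smaller» `(<)` (well-founded — `wf`), resolved
`s = 0`, step `s → s'` iff `s' + 1 = s`; every unresolved state `s ≠ 0` reaches in ONE step the state
`s − 1` of strictly smaller datum (`drop`).  A toy model of the abstract termination schema (§16.3), not
of Hironaka's resolution datum. [folklore] -/
theorem terminates_of_eventual_drop_hypotheses :
    ∃ (rel : ℕ → ℕ → Prop) (datum : ℕ → ℕ) (resolved : ℕ → Prop) (step : ℕ → ℕ → Prop),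
      WellFounded rel ∧
        ∀ s, ¬ resolved s → ∃ s', Relation.TransGen step s s' ∧ rel (datum s') (datum s) :=
  ⟨(· < ·), id, (· = 0), fun s s' => s' + 1 = s, wellFounded_lt, fun s hs =>
    ⟨s - 1, Relation.TransGen.single (by dsimp only at hs ⊢; omega), by dsimp only [id] at hs ⊢; omega⟩⟩

end Summit.ResolutionOfSingularities.KangarooAtlas.Runbook
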